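import Summits.ResolutionOfSingularities.ResolutionOfSingularities.Theorems.FrobeniusClosingPatchingRelPerfectMonomialPositions
import HarnessLib

/-!
# Crux `PatchingRelPerfect` (stmt-ResolutionOfSingularities-16161), chain w52 — M2-strong, SCHEME DICTIONARY
# part 2: POINTED-DISTINCT boundaries, position strata and the admissibility of the new strata

[OURS · L1 W5.2 · TargetsF3 (m) M2-strong, background line «stub-4 keeps the SCHEME dictionary»] Sequel of
`…MonomialPositions.lean` (position accessors `nthSheaf`/`nthExp`, positional weights).  PROVED here:

* `PointedDistinct Es` — distinct positions whose divisors share a point carry distinct divisors — with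
  `PointedDistinct.of_nodup` and **`PointedDistinct.transformBoundary`** (persists under the blow-up of a
  stratum; plain `Nodup` does not, strict transforms may become empty);
* `weightOf_image_nthSheaf_eq_sum` — for a pointed position set `J` the weight of `{Es[k] : k ∈ J}` is
  `Σ_{k∈J} nthExp A k`: the polyhedra game's move `x ↦ (x, |x_J| − m)` IS `transformExp · π T m`;
* ADMISSIBILITY of the strata after blowing up `{Es[k] : k ∈ J}`: a new stratum never contains all of `J`
  (`not_forall_mem_support_transformBoundary`) and projects to an old one, through `V(T)` when it contains
  the exceptional position (`common_point_old_of_new`).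

Fact-free; nothing here is a statement of the manuscript under review.

## References

* J. Kollár, *Lectures on Resolution of Singularities* (2007), (3.111) Step 3. [Kollar2007]
-/

-- `Summit.<Summit>.<Sub>.Theorems` with `Sub = Summit` (single-conjunct summit, D-0017)
set_option linter.dupNamespace false

noncomputable section

open CategoryTheory AlgebraicGeometry TopologicalSpace IsLocalRing
open Literature.AlgebraicGeometry.Resolution

namespace Summit.ResolutionOfSingularities.ResolutionOfSingularities.Theorems

namespace MonomialCleanup

universe u

/-! ## Pointed positions carry distinct divisors -/

section Pointed

variable {X : Scheme.{u}}

/-- **Distinct positions whose divisors share a point carry distinct divisors** (equivalently: a divisor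
occurring at two positions has empty support).  Holds for a duplicate-free boundary and PERSISTS under the
blow-up of a stratum (strict transforms may become empty — e.g. after the blow-up of a divisor itself —,
which is why plain `Nodup` does not persist). [folklore] -/
def PointedDistinct (Es : List X.IdealSheafData) : Prop :=
  ∀ k k' : ℕ, k < Es.length → k' < Es.length → k ≠ k' →
    ∀ x : X, x ∈ (nthSheaf Es k).support → x ∈ (nthSheaf Es k').support → nthSheaf Es k ≠ nthSheaf Es k'

/-- The divisor at position `k` of a duplicate-free list determines `k`. [folklore] -/
theorem nthSheaf_injective_of_nodup {Es : List X.IdealSheafData} (h : Es.Nodup) {k k' : ℕ}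
    (hk : k < Es.length) (hk' : k' < Es.length) (heq : nthSheaf Es k = nthSheaf Es k') : k = k' := by
  induction Es generalizing k k' with
  | nil => simp at hk
  | cons K t ih =>
    obtain ⟨hK, ht⟩ := List.nodup_cons.mp h
    cases k with
    | zero =>
      cases k' with
      | zero => rfl
      | succ k' =>
        rw [nthSheaf_cons_zero, nthSheaf_cons_succ] at heq
        exact absurd (heq ▸ nthSheaf_mem (by simpa using hk')) hK
    | succ k =>
      cases k' with
      | zero =>
        rw [nthSheaf_cons_zero, nthSheaf_cons_succ] at heq
        exact absurd (heq.symm ▸ nthSheaf_mem (by simpa using hk)) hK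
      | succ k' =>
        rw [nthSheaf_cons_succ, nthSheaf_cons_succ] at heq
        rw [ih ht (by simpa using hk) (by simpa using hk') heq]

/-- A duplicate-free boundary is pointed-distinct. [folklore] -/
theorem PointedDistinct.of_nodup {Es : List X.IdealSheafData} (h : Es.Nodup) : PointedDistinct Es :=
  fun _ _ hk hk' hne _ _ _ heq => hne (nthSheaf_injective_of_nodup h hk hk' heq)

variable [IsLocallyNoetherian X] {X' : Scheme.{u}} {π : X' ⟶ X} {T : Finset X.IdealSheafData}

/-- **Pointed-distinctness persists under the blow-up of a stratum.** [folklore] -/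
theorem PointedDistinct.transformBoundary {Es : List X.IdealSheafData} (hEs : HasSNC Es)
    (hT : ∀ K ∈ T, K ∈ Es) (hπ : IsBlowup π (T.sup id)) (hPD : PointedDistinct Es) :
    PointedDistinct (Es.map (strictTransformIdeal π (T.sup id)) ++ [(T.sup id).comap π]) := by
  intro k k' hk hk' hne x' hx hx' heq
  have hlen : (Es.map (strictTransformIdeal π (T.sup id)) ++ [(T.sup id).comap π]).length = Es.length + 1 := by
    simp
  rw [hlen] at hk hk'
  rcases Nat.lt_succ_iff_lt_or_eq.mp hk with hk | rfl
  · rcases Nat.lt_succ_iff_lt_or_eq.mp hk' with hk' | rfl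
    · -- two old positions: strict transforms of distinct pointed divisors
      rw [nthSheaf_transformBoundary_lt Es hk] at heq hx
      rw [nthSheaf_transformBoundary_lt Es hk'] at heq hx'
      have hK := eq_of_strictTransformIdeal_eq hEs hT hπ (nthSheaf_mem hk) (nthSheaf_mem hk') hx heq
      exact hPD k k' hk hk' hne (π x') (mem_support_of_mem_support_strictTransformIdeal hx)
        (mem_support_of_mem_support_strictTransformIdeal hx') hK
    · -- old position vs the exceptional position
      rw [nthSheaf_transformBoundary_lt Es hk, nthSheaf_transformBoundary_eq Es] at heq
      rw [nthSheaf_transformBoundary_eq Es] at hx'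
      exact strictTransformIdeal_ne_comap hEs hT hπ (nthSheaf_mem hk) hx' heq
  · rcases Nat.lt_succ_iff_lt_or_eq.mp hk' with hk' | hkk
    · rw [nthSheaf_transformBoundary_lt Es hk', nthSheaf_transformBoundary_eq Es] at heq
      rw [nthSheaf_transformBoundary_eq Es] at hx
      exact strictTransformIdeal_ne_comap hEs hT hπ (nthSheaf_mem hk') hx heq.symm
    · exact absurd hkk.symm hne

end Pointed

/-! ## The blow-up of the divisors at a pointed set of positions -/

section PositionStratum

variable {X : Scheme.{u}}

open Classical in
/-- Under pointed-distinctness, the positions carrying a divisor of the pointed position set `J` are exactly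
`J`. [folklore] -/
theorem mem_of_nthSheaf_mem_image {Es : List X.IdealSheafData} (hPD : PointedDistinct Es)
    {J : Finset ℕ} (hJ : ∀ k ∈ J, k < Es.length) {x : X} (hx : ∀ k ∈ J, x ∈ (nthSheaf Es k).support)
    {k : ℕ} (hk : k < Es.length) (hmem : nthSheaf Es k ∈ J.image (nthSheaf Es)) : k ∈ J := by
  obtain ⟨j, hj, hjk⟩ := Finset.mem_image.mp hmem
  by_cases h : k = j
  · exact h ▸ hj
  · have hxk : x ∈ (nthSheaf Es k).support := hjk ▸ hx j hj
    exact absurd hjk.symm (hPD k j hk (hJ j hj) h x hxk (hx j hj))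

open Classical in
/-- **The weight of the divisor set of a pointed position set is the sum of the exponents over the
positions** (so the game's move `x ↦ (x, |x_J| − m)` is the scheme's `transformExp · π T m`).
[folklore] -/
theorem weightOf_image_nthSheaf_eq_sum {A : List (X.IdealSheafData × ℕ)} (hPD : PointedDistinct (boundaryOf A))
    {J : Finset ℕ} (hJ : ∀ k ∈ J, k < A.length) {x : X}
    (hx : ∀ k ∈ J, x ∈ (nthSheaf (boundaryOf A) k).support) :
    weightOf A (J.image (nthSheaf (boundaryOf A))) = ∑ k ∈ J, nthExp A k := by
  rw [weightOf_eq_sum_nthExp, ← Finset.sum_filter]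
  congr 1
  ext k
  simp only [Finset.mem_filter, Finset.mem_range]
  constructor
  · rintro ⟨hk, hmem⟩
    exact mem_of_nthSheaf_mem_image hPD (fun j hj => (length_boundaryOf A).symm ▸ hJ j hj) hx
      ((length_boundaryOf A).symm ▸ hk) hmem
  · intro hk
    exact ⟨hJ k hk, Finset.mem_image_of_mem _ hk⟩

open Classical in
/-- The divisor set of a position set lies in the boundary. [folklore] -/
theorem image_nthSheaf_subset {Es : List X.IdealSheafData} {J : Finset ℕ} (hJ : ∀ k ∈ J, k < Es.length) :
    ∀ K ∈ J.image (nthSheaf Es), K ∈ Es := by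
  intro K hK
  obtain ⟨k, hk, rfl⟩ := Finset.mem_image.mp hK
  exact nthSheaf_mem (hJ k hk)

open Classical in
/-- A common point of the position set is a point of the stratum of its divisor set. [folklore] -/
theorem mem_support_finsetSup_image {Es : List X.IdealSheafData} {J : Finset ℕ} {x : X}
    (hx : ∀ k ∈ J, x ∈ (nthSheaf Es k).support) : x ∈ ((J.image (nthSheaf Es)).sup id).support := by
  refine (mem_support_finsetSup_iff _ x).mpr fun K hK => ?_
  obtain ⟨k, hk, rfl⟩ := Finset.mem_image.mp hK
  exact hx k hk

end PositionStratum

/-! ## Admissibility of the new strata -/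

section Admissible

variable {X X' : Scheme.{u}} [IsLocallyNoetherian X] {π : X' ⟶ X} {Es : List X.IdealSheafData}
  {J : Finset ℕ}

open Classical in
/-- **No point of the blow-up lies on the strict transforms of all divisors of the blown-up position set.**
[cite: Kollar2007, (3.111) Step 3] -/
theorem not_forall_mem_support_transformBoundary (hEs : HasSNC Es) (hJ : ∀ k ∈ J, k < Es.length)
    (hπ : IsBlowup π ((J.image (nthSheaf Es)).sup id)) (x' : X') :
    ¬ ∀ k ∈ J, x' ∈ (nthSheaf (Es.map (strictTransformIdeal π ((J.image (nthSheaf Es)).sup id)) ++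
      [((J.image (nthSheaf Es)).sup id).comap π]) k).support := by
  intro h
  set T := J.image (nthSheaf Es) with hTdef
  have hT : ∀ K ∈ T, K ∈ Es := image_nthSheaf_subset hJ
  -- `x'` lies over `V(T)`, hence on the exceptional divisor
  have hxT : π x' ∈ (T.sup id).support := mem_support_finsetSup_image fun k hk => by
    have := h k hk
    rw [nthSheaf_transformBoundary_lt Es (hJ k hk)] at this
    exact mem_support_of_mem_support_strictTransformIdeal this
  have hxF : x' ∈ ((T.sup id).comap π).support := by
    show x' ∈ (((T.sup id).comap π).support : Set X')
    rw [Scheme.IdealSheafData.support_comap]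
    exact hxT
  obtain ⟨K, hKT, hK⟩ := exists_not_mem_support_strictTransformIdeal hEs hT hπ hxF
  obtain ⟨k, hk, rfl⟩ := Finset.mem_image.mp hKT
  have := h k hk
  rw [nthSheaf_transformBoundary_lt Es (hJ k hk)] at this
  exact hK this

omit [IsLocallyNoetherian X] in
/-- **A common point of new divisors projects to a common point of the old divisors behind them — and of
the whole blown-up set if the exceptional divisor is among them.** [folklore] -/
theorem common_point_old_of_new {T : Finset X.IdealSheafData} {S' : Finset ℕ} {x' : X'}
    (hS' : ∀ k ∈ S', x' ∈ (nthSheaf (Es.map (strictTransformIdeal π (T.sup id)) ++ [(T.sup id).comap π]) k).support) :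
    (∀ k ∈ S', k < Es.length → π x' ∈ (nthSheaf Es k).support) ∧
      (Es.length ∈ S' → ∀ K ∈ T, π x' ∈ K.support) := by
  constructor
  · intro k hk hklt
    have h := hS' k hk
    rw [nthSheaf_transformBoundary_lt Es hklt] at h
    exact mem_support_of_mem_support_strictTransformIdeal h
  · intro hn K hK
    have h := hS' _ hn
    rw [nthSheaf_transformBoundary_eq Es] at h
    have h' : x' ∈ (((T.sup id).comap π).support : Set X') := h
    rw [Scheme.IdealSheafData.support_comap] at h'
    exact (mem_support_finsetSup_iff T _).mp h' K hK

end Admissible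

end MonomialCleanup

end Summit.ResolutionOfSingularities.ResolutionOfSingularities.Theorems

end
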